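import Summits.HodgeConjecture.HodgeConjecture.Theorems.F0HFOfSiegelModuli   -- ★ p807780 `F0HFOfSiegelModuli.lan2013_siegelFineModuliScheme_of_cores : lan2013_siegelFineModuliScheme` — (F) from the four ★ cores
import Literature.AlgebraicGeometry.HodgeTheory.SmoothProjectiveCompactification   -- ★ `HodgeTheory.isQuasiProjectiveOver_of_isIso` (quasi-projectivity along an isomorphism of `k`-schemes)
import HarnessLib

/-!
# (F) BY NAME, and EVERY Siegel fine moduli scheme at level `N ≥ 3` is smooth and quasi-projective

Cell `hodgecm-mathlib`, programme HC_CM FLOOR 0 (D-0183), route `HCCMUnconditional`.  HONEST LABEL: HC_CM is proved only modulo the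
7 printed citations until rung 0 closes; this file changes no binder of the headline and is not about Hodge classes.

## §1 The named fact (F) under its `_holds` name

`ledger route show route-HodgeConjecture-HCCMUnconditional` (director g15 s480, 2026-08-31) still lists the Literature named fact
`Literature.AlgebraicGeometry.ModuliOfAbelianVarieties.lan2013_siegelFineModuliScheme` ([Lan2013PELCompactifications] Thm. 1.4.1.11 +
Cor. 7.2.3.9 ∕ [MumfordFogartyKirwan1994] Thm. 7.9 with the remark following it, Thm. 7.10: for `0 < g`, a polarisation type `δ` and
`N ≥ 3` the Siegel moduli functor `𝓐_{g,δ,N}` is represented over `ℚ` by a smooth quasi-projective fine moduli scheme with quasi-projective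
universal family) among the route's `cite_only` dependencies, although the fact is PROVED in the tree — hypothesis-free, axioms the Lean
trio — by ★ `F0HFOfSiegelModuli.lan2013_siegelFineModuliScheme_of_cores` (★ F-12-of-cores ED. 3 `exists_threshold_siegelFineModuliScheme_of_cores''`
fed CORE II ★ `AbelianSchemeOver.exists_groupLawLocus_of_projective`, CORE F3 ★ `F3DualAbelianScheme.stub_F3_holds`, CORE PL ★
`F13PluckerProducer.stub_PL_of_cores_holds'`, CORE F11 ★ `F11SmoothRoadA.stub_F11_holds`, then ★ F-10 level descent
`lan2013_siegelFineModuliScheme_of_large_levels`).  The facts probe discharges a named fact `X` by a theorem NAMED `X_holds` of type `X`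
(the gate's dry-run of this file reports «net debt delta −1 (1 discharge)»); `lan2013_siegelFineModuliScheme_holds` supplies that name, as
★ `Theorems/HCCMUnconditionalSiegelDebtClosers.lean` did for the five other Siegel-floor facts (F′) ∕ (U) ∕ (M1′) ∕ (#60) ∕ [Mumford 1965].

## §2 What (F) gives for EVERY carrier (new, hypothesis-free)

(F) is an EXISTENCE statement about ONE fine moduli scheme; consumers hold an ARBITRARY `𝓜 : SiegelFineModuliScheme g N δ` and take its
clauses as hypotheses (★ `SiegelFineModuliSchemeLevelQuotientClauses.smooth_levelGroupQuotient_hom (hsm : Smooth 𝓜.M.hom)`, ★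
`SiegelFineModuliSchemeLevelGroupQuotientUniversal.exists_univ_desc_levelGroupQuotient_of_smooth [Smooth 𝓜.M.hom]`, …).  Since two fine
moduli schemes for the same `(g, N, δ)` are canonically isomorphic over `ℚ` (★ `SiegelFineModuliScheme.isoOfClassify`, Yoneda inside the
locally noetherian test category; [MumfordFogartyKirwan1994] Thm. 7.9, [Deligne1971TravauxShimura] 4.16 «représenté par un `ℚ`-schéma»),
and the universal triple of `𝓜` is the base change of that of `𝓜₀` along this isomorphism (`classify`), all three clauses of (F) transfer:

* `clauses_of_iso` — the transport: smoothness along `Over.w` (an isomorphism is an open immersion, hence smooth; Mathlib), quasi-projectivity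
  of `M` by ★ `isQuasiProjectiveOver_of_isIso`, quasi-projectivity of the universal family because the comparison map `G : 𝓜.univ.A.X → 𝓜₀.univ.A.X`
  of `classify` is a pull-back of an isomorphism (`IsPullback.isIso_fst_of_isIso`), hence an isomorphism over `Spec ℚ`;
* `clauses (𝓜) (hg) (hδ) (hN)` — for `0 < g`, `δ` a polarisation type, `3 ≤ N`: `Smooth 𝓜.M.hom ∧ IsQuasiProjectiveOver 𝓜.M ∧
  IsQuasiProjectiveOver (Over.mk (𝓜.univ.A.X.hom ≫ 𝓜.M.hom))` for EVERY `𝓜`; projections `smooth_hom`, `isQuasiProjectiveOver_carrier`,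
  `isQuasiProjectiveOver_universalFamily`;
* `nonempty_siegelFineModuliScheme (hg) (hδ) (hN)` — the bare inhabitation, hypothesis-free (the tree's only other `Nonempty` head, ★
  `SiegelFineModuliSchemeOfRepresentedCharts`, carries the twelve chart hypotheses of [MFK94] §7.3).

0 `def`, 0 `instance`, 0 `notation`, 0 `sorry`; theorems only; imports ★ Theorems ∕ ★ Literature ∕ HarnessLib.

## References (copied from the fact definition and the carrier file)
* [Lan2013PELCompactifications] K.-W. Lan, *Arithmetic compactifications of PEL-type Shimura varieties*, Thm. 1.4.1.11 and Cor. 1.4.1.12 p. 91, Cor. 7.2.3.9 p. 518.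
* [MumfordFogartyKirwan1994] D. Mumford, J. Fogarty, F. Kirwan, *Geometric Invariant Theory*, Ch. 7 §2 Def. 7.2–7.3 p. 129, Prop. 7.6 p. 136, §3 Thm. 7.9 with the remark following it and Thm. 7.10 p. 139.
* [Deligne1971TravauxShimura] P. Deligne, *Travaux de Shimura*, 4.16 p. 150.
-/

-- The summit and its single sub-problem are both named `HodgeConjecture` (D-0017 nested layout).
set_option linter.dupNamespace false

namespace Summit.HodgeConjecture.HodgeConjecture.Theorems.HCCMUnconditionalSiegelFineModuliDebtCloser

open CategoryTheory CategoryTheory.Limits AlgebraicGeometry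
open Literature.AlgebraicGeometry.ModuliOfAbelianVarieties
open Literature.AlgebraicGeometry.HodgeTheory (IsQuasiProjectiveOver isQuasiProjectiveOver_of_isIso)

/-! ## §1 (F) by name -/

/-- **(F) [Lan2013PELCompactifications, Thm. 1.4.1.11 + Cor. 7.2.3.9] ∕ [MumfordFogartyKirwan1994, Thm. 7.9–7.10] IS A THEOREM, BY NAME**:
for `0 < g`, a polarisation type `δ` and `N ≥ 3` the Siegel moduli functor `𝓐_{g,δ,N}` is represented over `ℚ` by a smooth
quasi-projective fine moduli scheme with quasi-projective universal family — the named fact `lan2013_siegelFineModuliScheme` under its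
`_holds` name, by the ★ theorem `F0HFOfSiegelModuli.lan2013_siegelFineModuliScheme_of_cores` (the four ★ cores II ∕ F3 ∕ PL ∕ F11 through
★ F-12-of-cores and ★ F-10 level descent).  HC_CM is proved only modulo the 7 printed citations until rung 0 closes.
[cite: Lan2013PELCompactifications, Thm. 1.4.1.11 (p. 91) and Cor. 7.2.3.9 (p. 518)]
[cite: MumfordFogartyKirwan1994, Ch. 7 §3 Theorem 7.9 with the remark following it and Theorem 7.10 (p. 139)] -/
theorem lan2013_siegelFineModuliScheme_holds : lan2013_siegelFineModuliScheme :=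
  Summit.HodgeConjecture.HodgeConjecture.Theorems.F0HFOfSiegelModuli.lan2013_siegelFineModuliScheme_of_cores

/-! ## §2 Every Siegel fine moduli scheme at level `N ≥ 3` is smooth and quasi-projective -/

variable {g N : ℕ} {δ : Fin g → ℕ}

/-- **Transport of the three clauses of (F) along the canonical isomorphism of fine moduli schemes**
([MumfordFogartyKirwan1994, Thm. 7.9]: the representing object is unique up to a unique isomorphism compatible with the universal
triples — ★ `SiegelFineModuliScheme.isoOfClassify` and `classify`): if SOME fine moduli scheme `𝓜₀` for `(g, N, δ)` has smooth
quasi-projective carrier and quasi-projective universal family, then so does EVERY fine moduli scheme `𝓜` for `(g, N, δ)`.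
Smoothness moves along `Over.w` (an isomorphism is an open immersion, hence smooth); quasi-projectivity of the carrier by ★
`isQuasiProjectiveOver_of_isIso`; for the universal family, the comparison map `G` of `classify` sits in a cartesian square over the
isomorphism `𝓜.M ≅ 𝓜₀.M`, so it is itself an isomorphism (`IsPullback.isIso_fst_of_isIso`) over `Spec ℚ`.
[cite: MumfordFogartyKirwan1994, Ch. 7 §3 Theorem 7.9 (p. 139) and §2 Definitions 7.2–7.3 (p. 129)]
[cite: Deligne1971TravauxShimura, 4.16 p. 150] -/
theorem clauses_of_iso (𝓜 𝓜₀ : SiegelFineModuliScheme g N δ)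
    (h₀ : Smooth 𝓜₀.M.hom ∧ IsQuasiProjectiveOver 𝓜₀.M ∧
      IsQuasiProjectiveOver (Over.mk (𝓜₀.univ.A.X.hom ≫ 𝓜₀.M.hom))) :
    Smooth 𝓜.M.hom ∧ IsQuasiProjectiveOver 𝓜.M ∧ IsQuasiProjectiveOver (Over.mk (𝓜.univ.A.X.hom ≫ 𝓜.M.hom)) := by
  obtain ⟨hsm, hqp, hqpu⟩ := h₀
  haveI := 𝓜.isLocallyNoetherian
  haveI := 𝓜₀.isLocallyNoetherian
  -- the canonical isomorphism `𝓜.M ≅ 𝓜₀.M` over `Spec ℚ`; its `hom` is the classifying morphism of `𝓜.univ` for `𝓜₀`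
  -- (`SiegelFineModuliScheme.isoOfClassify_hom` is `rfl`, so the underlying scheme map of the iso IS `(classifyingMap).left`)
  haveI hiso : IsIso (𝓜₀.classifyingMap 𝓜.M 𝓜.univ).left :=
    (Over.forget _).map_isIso (SiegelFineModuliScheme.isoOfClassify 𝓜 𝓜₀).hom
  have hw : (𝓜₀.classifyingMap 𝓜.M 𝓜.univ).left ≫ 𝓜₀.M.hom = 𝓜.M.hom := Over.w _
  refine ⟨?_, isQuasiProjectiveOver_of_isIso (𝓜₀.classifyingMap 𝓜.M 𝓜.univ) hqp, ?_⟩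
  · -- smoothness: `𝓜.M.hom = (iso) ≫ 𝓜₀.M.hom`
    rw [← hw]
    haveI := hsm
    infer_instance
  · -- the universal family: `𝓜.univ` is the base change of `𝓜₀.univ` along the classifying morphism
    obtain ⟨G, Ĝ, hBC⟩ := 𝓜₀.exists_isBaseChangeVia_classifyingMap 𝓜.M 𝓜.univ
    obtain ⟨⟨⟨wA, hpb, -, -⟩, -⟩, -⟩ := hBC
    -- `wA : G ≫ 𝓜₀.univ.A.X.hom = 𝓜.univ.A.X.hom ≫ (classifying morphism).left`, `hpb` the cartesian square
    haveI : IsIso G := hpb.isIso_fst_of_isIso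
    let φ : Over.mk (𝓜.univ.A.X.hom ≫ 𝓜.M.hom) ⟶ Over.mk (𝓜₀.univ.A.X.hom ≫ 𝓜₀.M.hom) :=
      Over.homMk G (by
        change G ≫ 𝓜₀.univ.A.X.hom ≫ 𝓜₀.M.hom = 𝓜.univ.A.X.hom ≫ 𝓜.M.hom
        rw [← Category.assoc, wA, Category.assoc, hw])
    haveI : IsIso φ.left := by change IsIso G; infer_instance
    exact isQuasiProjectiveOver_of_isIso φ hqpu

/-- **EVERY Siegel fine moduli scheme at level `N ≥ 3` satisfies the three clauses of (F)** ([Lan2013PELCompactifications, Thm. 1.4.1.11 +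
Cor. 7.2.3.9]; [MumfordFogartyKirwan1994, Thm. 7.9 with the remark following it]): for `0 < g`, a polarisation type `δ` and `3 ≤ N`,
every `𝓜 : SiegelFineModuliScheme g N δ` has `𝓜.M → Spec ℚ` smooth, `𝓜.M` quasi-projective over `ℚ`, and the total space of its universal
abelian scheme quasi-projective over `ℚ` — (F) by name (§1) gives one such `𝓜₀`, `clauses_of_iso` transports.
[cite: Lan2013PELCompactifications, Thm. 1.4.1.11 (p. 91) and Cor. 7.2.3.9 (p. 518)]
[cite: MumfordFogartyKirwan1994, Ch. 7 §3 Theorem 7.9 with the remark following it and Theorem 7.10 (p. 139)] -/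
theorem clauses (𝓜 : SiegelFineModuliScheme g N δ) (hg : 0 < g) (hδ : IsPolarizationType δ) (hN : 3 ≤ N) :
    Smooth 𝓜.M.hom ∧ IsQuasiProjectiveOver 𝓜.M ∧ IsQuasiProjectiveOver (Over.mk (𝓜.univ.A.X.hom ≫ 𝓜.M.hom)) := by
  obtain ⟨𝓜₀, h₀⟩ := lan2013_siegelFineModuliScheme_holds g N δ hg hδ hN
  exact clauses_of_iso 𝓜 𝓜₀ h₀

/-- **Every Siegel fine moduli scheme at level `N ≥ 3` is SMOOTH over `ℚ`** ([Lan2013PELCompactifications, Thm. 1.4.1.11 «smooth»]) — the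
`(hsm : Smooth 𝓜.M.hom)` binder of the level-quotient files, discharged for every carrier.
[cite: Lan2013PELCompactifications, Thm. 1.4.1.11 (p. 91)] [cite: MumfordFogartyKirwan1994, Ch. 7 §3 Theorem 7.9 (p. 139)] -/
theorem smooth_hom (𝓜 : SiegelFineModuliScheme g N δ) (hg : 0 < g) (hδ : IsPolarizationType δ) (hN : 3 ≤ N) :
    Smooth 𝓜.M.hom :=
  (clauses 𝓜 hg hδ hN).1

/-- **Every Siegel fine moduli scheme at level `N ≥ 3` is QUASI-PROJECTIVE over `ℚ`** ([Lan2013PELCompactifications, Cor. 7.2.3.9];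
[MumfordFogartyKirwan1994, Thm. 7.9 «quasi-projective»]).
[cite: Lan2013PELCompactifications, Cor. 7.2.3.9 (p. 518)] [cite: MumfordFogartyKirwan1994, Ch. 7 §3 Theorem 7.9 (p. 139)] -/
theorem isQuasiProjectiveOver_carrier (𝓜 : SiegelFineModuliScheme g N δ) (hg : 0 < g) (hδ : IsPolarizationType δ)
    (hN : 3 ≤ N) : IsQuasiProjectiveOver 𝓜.M :=
  (clauses 𝓜 hg hδ hN).2.1

/-- **The universal abelian scheme of every Siegel fine moduli scheme at level `N ≥ 3` has QUASI-PROJECTIVE total space over `ℚ`**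
([MumfordFogartyKirwan1994, Prop. 7.6 with the proof of Thm. 7.9]: the universal family is projective over the quasi-projective base).
[cite: MumfordFogartyKirwan1994, Ch. 7 §2 Proposition 7.6 (p. 136) and §3 Theorem 7.9 (p. 139)] -/
theorem isQuasiProjectiveOver_universalFamily (𝓜 : SiegelFineModuliScheme g N δ) (hg : 0 < g)
    (hδ : IsPolarizationType δ) (hN : 3 ≤ N) : IsQuasiProjectiveOver (Over.mk (𝓜.univ.A.X.hom ≫ 𝓜.M.hom)) :=
  (clauses 𝓜 hg hδ hN).2.2

/-- **The fine moduli carrier type is INHABITED at every admissible `(g, N, δ)`, hypothesis-free** ([Deligne1971TravauxShimura, 4.16]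
«pour `n ≥ 3` … le foncteur `F` est représenté par un `ℚ`-schéma»; by ★ `SiegelFineModuliScheme.isoOfClassify` this names ONE `ℚ`-scheme up
to isomorphism).
[cite: Deligne1971TravauxShimura, 4.16 p. 150] [cite: MumfordFogartyKirwan1994, Ch. 7 §3 Theorem 7.9 with the remark following it (p. 139)] -/
theorem nonempty_siegelFineModuliScheme (hg : 0 < g) (hδ : IsPolarizationType δ) (hN : 3 ≤ N) :
    Nonempty (SiegelFineModuliScheme g N δ) := by
  obtain ⟨𝓜, -⟩ := lan2013_siegelFineModuliScheme_holds g N δ hg hδ hN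
  exact ⟨𝓜⟩

end Summit.HodgeConjecture.HodgeConjecture.Theorems.HCCMUnconditionalSiegelFineModuliDebtCloser
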